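import Literature.Computability.QuantumComplexity.ReversibleCliffordT
import Literature.Computability.Cryptography.KitaevPhaseEstimationSums
import HarnessLib

/-!
# Kitaev's eigenvalue measurement, III: the circuit, its amplitudes and its outcome distribution

Family `PQC` (trunk `CryptoQuantFine`); groundwork for the quantum half of Shor's order-finding
theorem (`Literature.Computability.Cryptography.Shor1997_orderFinding_isQSolvable`, `ShorProofs.lean`) along Kitaev's route
(A. Yu. Kitaev 1995, §3). Over the tree's circuit model (`QCircuit cliffordT`, matrix semantics
`QCircuit.toMatrix`, layout helpers `coinWire`/`coinInput`/`hadamardLayer` of `BQPProofs`) we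
build Kitaev's eigenvalue-measurement circuit with *all Hadamard tests in parallel* and compute
its output distribution exactly:

* layout `tri x y ρ` (input wires `x`, `k` control wires `y`, `m` work wires `ρ`) and its
  bookkeeping (`triEquiv`, `update_tri_coinWire`, `eq_tri_iff`);
* `hadamards_mulVec_basisState_signed` — Hadamard gates on distinct wires applied to an
  *arbitrary* basis state, `(∏_{i∈ws} H_i)|w⟩ = 2^{-|ws|/2} ∑_{z ≡ w off ws} (-1)^{w·z} |z⟩`
  (Nielsen–Chuang 2010, eq. (1.50)); `hadamardLayer_mulVec_tri`;
* the phase layer `phaseLayer σ` (three `S` gates, `S³ = S†`, on each sine-test control) and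
  `phaseLayer_mulVec_tri` (Kitaev 1995, §3, Remark 8: "if we substitute `iU` for `U` then
  `cos 2πφ` will change to `-sin 2πφ`"; here realised as the phase `-i` on the control);
* `kitaevCircuit V σ = H_controls; V; S³_σ; H_controls` for a classical block `V`, with
  `kitaevCircuit_isOracleFree`, the output state `kitaevCircuit_runOn` and amplitudes
  `kitaevCircuit_runOn_tri` (`ψ(x γ ρ) = 2^{-k} ∑_{y : R y = ρ} (-i)^{#σ∧y} (-1)^{y·γ}` when
  `V` acts as `|x y 0^m⟩ ↦ |x y (R y)⟩`), `kitaevCircuit_runOn_of_ne`,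
  `kitaevCircuit_prob_controls`;
* `testWeight`, `trialExp`, `testAngle` and the main result `kitaevCircuit_distribution`
  (Kitaev 1995, §3, Remark 8 and Lemma 8, with §4, p. 15, `P(h) = q⁻¹ ∑_{h'} P(h', h)`): if the
  block writes a work-register content `R y` separating exactly the residues modulo `r` of the
  trial exponents `A_t(y) = ∑_{τ j = t} y_j 2^{e_j}` (as `R y = (x^{A_1(y)} mod N, …)` does for
  `r = ord_N(x)`), then the control read-out `γ` has Born probability
  `r^{-K} ∑_{s ∈ (ℤ/r)^K} ∏_j (1 + (-1)^{γ_j} trig_j(2π s_{τ j} 2^{e_j}/r))/2` — a uniformly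
  random eigenvalue index per trial, then independent Hadamard tests
  (`parseval_fibers`, `sum_prod_mul_exp_eq_prod`, `norm_sq_testAmplitude` of
  `KitaevPhaseEstimationSums`).

## References

* A. Yu. Kitaev, *Quantum measurements and the Abelian Stabilizer Problem*,
  arXiv:quant-ph/9511026 (1995), §3: Remark 8 (`Ξ(U) = S Λ(U) S`,
  `P(φ, 0) = (1 + cos 2πφ)/2`), Lemma 8 (composite probability formula; measurements with
  disjoint additional registers multiply), Lemma 10 (the operator `U^{[0,r]}`: all powers
  `U^{2^j}` controlled by separate bits) — pp. 13–14 of the arXiv version; §4, p. 15.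
* M. A. Nielsen, I. L. Chuang, *Quantum Computation and Quantum Information*, CUP 2010, §1.4.4,
  eq. (1.50) (`H^{⊗n}|x⟩`); §4.2 (`S` gate).
* P. W. Shor, *Polynomial-time algorithms for prime factorization and discrete logarithms on a
  quantum computer*, SIAM J. Comput. 26 (1997) 1484–1509, §5 (the theorem served).

## Tree

`QCircuit`, `QCircuit.toMatrix`/`runOn`, `basisState`, `padInput` (`QuantumCircuit`,
`QubitRegister`); `hOn`, `hOn_mulVec_basisState'`, `hOn_isOracleFree`, `invSqrt2`, `coinWire`,
`coinWires`, `coinInput`, `hadamardLayer`, `hadamardLayer_mulVec_padInput` (`BQPProofs`);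
`sOn`, `sOn_mulVec_basisState`, `sOn_isOracleFree` (`ReversibleCliffordT`).
-/


noncomputable section

namespace Literature.Computability.Cryptography

namespace Kitaev1995

open _root_.Computability Complexity QuantumComplexity Matrix Finset

/-! ### Register layout `x y ρ` -/

section layout

variable {n k m : ℕ}

/-- The basis label `x y ρ` of a register with `n` input wires holding `x`, `k` control wires
holding `y` and `m` work wires holding `ρ` (`coinInput x y = tri x y 0^m`). [folklore] -/
def tri (x : QReg n) (y : QReg k) (ρ : QReg m) : QReg (n + (k + m)) :=
  Fin.append x (Fin.append y ρ)

/-- Input wires of `x y ρ` hold `x`. [folklore] -/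
@[simp] theorem tri_castAdd (x : QReg n) (y : QReg k) (ρ : QReg m) (i : Fin n) :
    tri x y ρ (Fin.castAdd (k + m) i) = x i := by
  simp [tri]

/-- Control wires of `x y ρ` hold `y`. [folklore] -/
@[simp] theorem tri_coinWire (x : QReg n) (y : QReg k) (ρ : QReg m) (j : Fin k) :
    tri x y ρ (coinWire n k m j) = y j := by
  simp [tri, coinWire]

/-- Work wires of `x y ρ` hold `ρ`. [folklore] -/
@[simp] theorem tri_work (x : QReg n) (y : QReg k) (ρ : QReg m) (l : Fin m) :
    tri x y ρ (Fin.natAdd n (Fin.natAdd k l)) = ρ l := by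
  simp [tri]

/-- `coinInput x y` is `x y 0^m`. [folklore] -/
theorem coinInput_eq_tri (x : QReg n) (y : QReg k) :
    coinInput (m := m) x y = tri x y (fun _ => false) := rfl

/-- The label `x y ρ` determines `x`, `y` and `ρ`. [folklore] -/
theorem tri_eq_tri_iff {x x' : QReg n} {y y' : QReg k} {ρ ρ' : QReg m} :
    tri x y ρ = tri x' y' ρ' ↔ x = x' ∧ y = y' ∧ ρ = ρ' := by
  constructor
  · intro h
    refine ⟨funext fun i => ?_, funext fun j => ?_, funext fun l => ?_⟩
    · simpa using congrFun h (Fin.castAdd (k + m) i)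
    · simpa using congrFun h (coinWire n k m j)
    · simpa using congrFun h (Fin.natAdd n (Fin.natAdd k l))
  · rintro ⟨rfl, rfl, rfl⟩; rfl

/-- Splitting a register into its input, control and work parts. [folklore] -/
def triEquiv (n k m : ℕ) : QReg n × QReg k × QReg m ≃ QReg (n + (k + m)) where
  toFun p := tri p.1 p.2.1 p.2.2
  invFun z := (fun i => z (Fin.castAdd (k + m) i), fun j => z (coinWire n k m j),
    fun l => z (Fin.natAdd n (Fin.natAdd k l)))
  left_inv p := by
    obtain ⟨x, y, ρ⟩ := p
    simp
  right_inv z := by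
    funext i
    induction i using Fin.addCases with
    | left i => simp
    | right i =>
      induction i using Fin.addCases with
      | left j => exact tri_coinWire _ _ _ j
      | right l => simp

/-- Every register label is of the form `x y ρ`. [folklore] -/
theorem tri_parts (z : QReg (n + (k + m))) :
    tri (fun i => z (Fin.castAdd (k + m) i)) (fun j => z (coinWire n k m j))
      (fun l => z (Fin.natAdd n (Fin.natAdd k l))) = z :=
  (triEquiv n k m).right_inv z

/-- Input wires are not control wires. [folklore] -/
theorem castAdd_not_mem_coinWires (i : Fin n) : Fin.castAdd (k + m) i ∉ coinWires n k m := by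
  rw [mem_coinWires_iff, mem_range_coinWire_iff]
  simp

/-- Work wires are not control wires. [folklore] -/
theorem work_not_mem_coinWires (l : Fin m) :
    Fin.natAdd n (Fin.natAdd k l) ∉ coinWires n k m := by
  rw [mem_coinWires_iff, mem_range_coinWire_iff]
  simp

/-- Input wires are not control wires (pointwise form). [folklore] -/
theorem coinWire_ne_castAdd (j : Fin k) (i : Fin n) : coinWire n k m j ≠ Fin.castAdd (k + m) i :=
  fun h => castAdd_not_mem_coinWires i (h ▸ (mem_coinWires_iff _).2 ⟨j, rfl⟩)

/-- Work wires are not control wires (pointwise form). [folklore] -/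
theorem coinWire_ne_work (j : Fin k) (l : Fin m) :
    coinWire n k m j ≠ Fin.natAdd n (Fin.natAdd k l) :=
  fun h => work_not_mem_coinWires l (h ▸ (mem_coinWires_iff _).2 ⟨j, rfl⟩)

/-- Updating a control wire of `x y ρ` updates `y`. [folklore] -/
theorem update_tri_coinWire (x : QReg n) (y : QReg k) (ρ : QReg m) (j : Fin k) (b : Bool) :
    Function.update (tri x y ρ) (coinWire n k m j) b = tri x (Function.update y j b) ρ := by
  rw [← tri_parts (Function.update (tri x y ρ) (coinWire n k m j) b), tri_eq_tri_iff]
  refine ⟨funext fun i => ?_, funext fun j' => ?_, funext fun l => ?_⟩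
  · rw [Function.update_of_ne (coinWire_ne_castAdd j i).symm, tri_castAdd]
  · by_cases hj : j' = j
    · subst hj; simp
    · rw [Function.update_of_ne (fun h => hj (coinWire_injective n k m h)),
        Function.update_of_ne hj, tri_coinWire]
  · rw [Function.update_of_ne (coinWire_ne_work j l).symm, tri_work]

/-- A label agrees with `x y ρ` off the control wires iff it is `x y' ρ` with `y'` its own
control part. [folklore] -/
theorem eq_tri_iff (x : QReg n) (y : QReg k) (ρ : QReg m) (z : QReg (n + (k + m)))
    (y' : QReg k) :
    z = tri x y' ρ ↔
      (∀ i, i ∉ coinWires n k m → z i = tri x y ρ i) ∧ (fun j => z (coinWire n k m j)) = y' := by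
  constructor
  · rintro rfl
    refine ⟨fun i hi => ?_, funext fun j => by simp⟩
    rw [mem_coinWires_iff] at hi
    induction i using Fin.addCases with
    | left i => simp
    | right i =>
      induction i using Fin.addCases with
      | left j => exact absurd ⟨j, rfl⟩ hi
      | right l => simp
  · rintro ⟨h1, rfl⟩
    conv_lhs => rw [← tri_parts z]
    rw [tri_eq_tri_iff]
    refine ⟨funext fun i => ?_, rfl, funext fun l => ?_⟩
    · rw [h1 _ (castAdd_not_mem_coinWires i), tri_castAdd]
    · rw [h1 _ (work_not_mem_coinWires l), tri_work]

end layout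


/-! ### A layer of Hadamard gates on an arbitrary basis state -/

section hadamards

variable {N : ℕ}

/-- The sign `(-1)^{∑_{i ∈ ws} w_i z_i}` picked up by `|z⟩` when Hadamard gates on the wires
`ws` are applied to `|w⟩`, as a product over the list. [Nielsen–Chuang 2010, §1.4.4, eq.
(1.50): `H^{⊗n}|x⟩ = 2^{-n/2} ∑_z (-1)^{x·z} |z⟩`] [folklore] -/
def hSign (ws : List (Fin N)) (w z : QReg N) : ℂ :=
  (ws.map fun i => if w i && z i then (-1 : ℂ) else 1).prod

/-- `hSign` of the empty list is `1`. [folklore] -/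
@[simp] theorem hSign_nil (w z : QReg N) : hSign [] w z = 1 := by simp [hSign]

/-- `hSign` of a cons. [folklore] -/
theorem hSign_cons (i : Fin N) (ws : List (Fin N)) (w z : QReg N) :
    hSign (i :: ws) w z = (if w i && z i then (-1 : ℂ) else 1) * hSign ws w z := by
  simp [hSign]

/-- `hSign ws` only depends on the values of `w` on `ws`. [folklore] -/
theorem hSign_congr_left {ws : List (Fin N)} {w w' : QReg N} (z : QReg N)
    (h : ∀ i ∈ ws, w i = w' i) : hSign ws w z = hSign ws w' z := by
  unfold hSign
  congr 1
  exact List.map_congr_left fun i hi => by rw [h i hi]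

/-- **Hadamard gates on distinct wires, applied to an arbitrary basis state**:
`(∏_{i ∈ ws} H_i)|w⟩ = 2^{-|ws|/2} ∑_{z ≡ w off ws} (-1)^{∑_{i∈ws} w_i z_i} |z⟩`
(Nielsen–Chuang 2010, §1.4.4, eq. (1.50)); generalises `hadamards_mulVec_basisState`
(`w = 0` on `ws`). [cite: NielsenChuang2010, §1.4.4] -/
theorem hadamards_mulVec_basisState_signed (ws : List (Fin N)) (hws : ws.Nodup) (w : QReg N) :
    (⟨ws.map hOn⟩ : QCircuit cliffordT N).toMatrix 0 *ᵥ basisState w =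
      fun z => if (∀ j, j ∉ ws → z j = w j) then invSqrt2 ^ ws.length * hSign ws w z else 0 := by
  induction ws generalizing w with
  | nil =>
    ext z
    simp only [List.map_nil, QCircuit.toMatrix_nil, Matrix.one_mulVec, basisState_apply,
      List.not_mem_nil, not_false_eq_true, forall_const, List.length_nil, pow_zero, hSign_nil,
      mul_one]
    simp [funext_iff]
  | cons i ws ih =>
    have hi : i ∉ ws := (List.nodup_cons.1 hws).1
    have hws' : ws.Nodup := (List.nodup_cons.1 hws).2
    ext z
    rw [List.map_cons, QCircuit.toMatrix_cons, ← Matrix.mulVec_mulVec,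
      hOn_mulVec_basisState' 0 i w, Matrix.mulVec_smul, Matrix.mulVec_add, Matrix.mulVec_smul,
      ih hws' (Function.update w i false), ih hws' (Function.update w i true)]
    simp only [Pi.smul_apply, Pi.add_apply, smul_eq_mul, List.length_cons, pow_succ, hSign_cons]
    -- the signs over `ws` do not see wire `i`
    have hs0 : hSign ws (Function.update w i false) z = hSign ws w z :=
      hSign_congr_left z fun l hl => Function.update_of_ne (fun e : l = i => hi (e ▸ hl)) _ _
    have hs1 : hSign ws (Function.update w i true) z = hSign ws w z :=
      hSign_congr_left z fun l hl => Function.update_of_ne (fun e : l = i => hi (e ▸ hl)) _ _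
    rw [hs0, hs1]
    -- agreement off `ws` with `w[i ↦ b]` means agreement off `i :: ws` with `w` and `z i = b`
    have hagree : ∀ b : Bool, (∀ j, j ∉ ws → z j = Function.update w i b j) ↔
        ((∀ j, j ∉ i :: ws → z j = w j) ∧ z i = b) := by
      intro b
      constructor
      · intro h
        refine ⟨fun j hj => ?_, by simpa using h i hi⟩
        have hji : j ≠ i := fun e => hj (e ▸ List.mem_cons_self ..)
        rw [h j (fun hj' => hj (List.mem_cons_of_mem _ hj')), Function.update_of_ne hji]
      · rintro ⟨h, hzi⟩ j hj
        by_cases hji : j = i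
        · subst hji; rw [Function.update_self]; exact hzi
        · rw [Function.update_of_ne hji]
          exact h j (by simp [hji, hj])
    by_cases hC : ∀ j, j ∉ i :: ws → z j = w j
    · rw [if_pos hC]
      cases hzi : z i
      · rw [if_pos (c := ∀ j, j ∉ ws → z j = Function.update w i false j)
            ((hagree false).2 ⟨hC, hzi⟩),
          if_neg (c := ∀ j, j ∉ ws → z j = Function.update w i true j)
            (fun h => by have := ((hagree true).1 h).2; rw [hzi] at this; simp at this)]
        cases w i <;> simp <;> ring
      · rw [if_neg (c := ∀ j, j ∉ ws → z j = Function.update w i false j)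
            (fun h => by have := ((hagree false).1 h).2; rw [hzi] at this; simp at this),
          if_pos (c := ∀ j, j ∉ ws → z j = Function.update w i true j)
            ((hagree true).2 ⟨hC, hzi⟩)]
        cases w i <;> simp <;> ring
    · rw [if_neg hC, if_neg (c := ∀ j, j ∉ ws → z j = Function.update w i false j)
        (fun h => hC ((hagree false).1 h).1),
        if_neg (c := ∀ j, j ∉ ws → z j = Function.update w i true j)
        (fun h => hC ((hagree true).1 h).1)]
      ring

end hadamards

/-! ### The Hadamard layer on the control wires of `x y ρ` -/

section hadamardLayer

variable {n k m : ℕ}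

/-- The sign `(-1)^{y · y'}`. [folklore] -/
def ySign (y y' : QReg k) : ℂ := ∏ j, if y j && y' j then (-1 : ℂ) else 1

/-- `hSign` over the control wires of `x y ρ` against `z` is `(-1)^{y · z|_controls}`.
[folklore] -/
theorem hSign_coinWires (x : QReg n) (y : QReg k) (ρ : QReg m) (z : QReg (n + (k + m))) :
    hSign (coinWires n k m) (tri x y ρ) z = ySign y (fun j => z (coinWire n k m j)) := by
  rw [hSign, ySign, coinWires, List.map_map, ← List.ofFn_eq_map, List.prod_ofFn]
  refine prod_congr rfl fun j _ => ?_
  simp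

/-- **The Hadamard layer on the control wires**:
`H_controls |x y ρ⟩ = 2^{-k/2} ∑_{y'} (-1)^{y·y'} |x y' ρ⟩`.
[Nielsen–Chuang 2010, §1.4.4, eq. (1.50)] [cite: NielsenChuang2010, §1.4.4] -/
theorem hadamardLayer_mulVec_tri (x : QReg n) (y : QReg k) (ρ : QReg m) :
    (⟨hadamardLayer n k m⟩ : QCircuit cliffordT (n + (k + m))).toMatrix 0 *ᵥ
        basisState (tri x y ρ) =
      invSqrt2 ^ k • ∑ y' : QReg k, ySign y y' • basisState (tri x y' ρ) := by
  rw [hadamardLayer, hadamards_mulVec_basisState_signed _ coinWires_nodup]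
  ext z
  simp only [Pi.smul_apply, Finset.sum_apply, smul_eq_mul, basisState_apply, length_coinWires,
    mul_ite, mul_one, mul_zero]
  by_cases hP : ∀ i, i ∉ coinWires n k m → z i = tri x y ρ i
  · rw [if_pos hP, Finset.sum_eq_single (fun j => z (coinWire n k m j))]
    · rw [if_pos ((eq_tri_iff x y ρ z _).2 ⟨hP, rfl⟩), hSign_coinWires]
    · intro y' _ hy'
      exact if_neg fun h => hy' ((eq_tri_iff x y ρ z y').1 h).2.symm
    · intro h; exact absurd (Finset.mem_univ _) h
  · rw [if_neg hP, Finset.sum_eq_zero fun y' _ => if_neg fun h => hP ((eq_tri_iff x y ρ z y').1 h).1,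
      mul_zero]

end hadamardLayer


/-! ### The phase layer: `S³ = S†` on the sine-test control wires -/

section phase

variable {N : ℕ}

/-- Three `S` gates (`S³ = S†`) on wire `i` multiply `|w⟩` by `(-i)^{w i}` (Kitaev 1995, §3,
Remark 8: "if we substitute `iU` for `U`", realised as a phase `-i = i³` on the control).
[cite: Kitaev1995, §3 Remark 8] -/
theorem sss_mulVec_basisState (i : Fin N) (w : QReg N) :
    (⟨[sOn i, sOn i, sOn i]⟩ : QCircuit cliffordT N).toMatrix 0 *ᵥ basisState w =
      (if w i then -Complex.I else 1) • basisState w := by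
  rw [QCircuit.toMatrix_cons, QCircuit.toMatrix_cons, QCircuit.toMatrix_cons,
    QCircuit.toMatrix_nil, Matrix.one_mul, ← Matrix.mulVec_mulVec, ← Matrix.mulVec_mulVec,
    sOn_mulVec_basisState, Matrix.mulVec_smul, sOn_mulVec_basisState, Matrix.mulVec_smul,
    Matrix.mulVec_smul, sOn_mulVec_basisState, smul_smul, smul_smul]
  congr 1
  cases w i
  · simp
  · simp only [if_true]
    rw [mul_assoc, Complex.I_mul_I]; ring

variable {n k m : ℕ}

/-- The phase layer over the control wires listed in `L`: three `S` gates on each sine-test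
control (`σ j = true`), nothing on cosine-test controls. [cite: Kitaev1995, §3 Remark 8] -/
def phaseLayerL (n k m : ℕ) (L : List (Fin k)) (σ : Fin k → Bool) :
    List (QGate cliffordT (n + (k + m))) :=
  L.flatMap fun j => if σ j then
    [sOn (coinWire n k m j), sOn (coinWire n k m j), sOn (coinWire n k m j)] else []

/-- The phase layer: `S³` on every sine-test control wire. [cite: Kitaev1995, §3 Remark 8] -/
def phaseLayer (n k m : ℕ) (σ : Fin k → Bool) : List (QGate cliffordT (n + (k + m))) :=
  phaseLayerL n k m (List.finRange k) σ

/-- The phase `(-i)^{#{j : σ j ∧ y j}}` of the control string `y`. [folklore] -/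
def sPhase (σ : Fin k → Bool) (y : QReg k) : ℂ := ∏ j, if σ j && y j then -Complex.I else 1

/-- The gates of the phase layer are `S` gates, hence oracle-free. [folklore] -/
theorem phaseLayerL_isOracleFree (L : List (Fin k)) (σ : Fin k → Bool) :
    ∀ g ∈ phaseLayerL n k m L σ, g.IsOracleFree := by
  intro g hg
  simp only [phaseLayerL, List.mem_flatMap] at hg
  obtain ⟨j, -, hj⟩ := hg
  split_ifs at hj
  · simp only [List.mem_cons, List.not_mem_nil, or_false] at hj
    rcases hj with rfl | rfl | rfl <;> exact sOn_isOracleFree _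
  · simp at hj

/-- The phase layer over `L` multiplies `|z⟩` by `∏_{j ∈ L} (-i)^{[σ j ∧ z_{c_j}]}`. [folklore] -/
theorem phaseLayerL_mulVec_basisState (L : List (Fin k)) (σ : Fin k → Bool)
    (z : QReg (n + (k + m))) :
    (⟨phaseLayerL n k m L σ⟩ : QCircuit cliffordT _).toMatrix 0 *ᵥ basisState z =
      (L.map fun j => if σ j && z (coinWire n k m j) then -Complex.I else 1).prod •
        basisState z := by
  induction L with
  | nil => simp [phaseLayerL]
  | cons j L ih =>
    have hsplit : (⟨phaseLayerL n k m (j :: L) σ⟩ : QCircuit cliffordT (n + (k + m))) =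
        (⟨if σ j then [sOn (coinWire n k m j), sOn (coinWire n k m j), sOn (coinWire n k m j)]
          else []⟩ : QCircuit cliffordT _).append ⟨phaseLayerL n k m L σ⟩ := by
      simp [phaseLayerL, QCircuit.append]
    rw [hsplit, QCircuit.toMatrix_append, ← Matrix.mulVec_mulVec]
    have hhead : (⟨if σ j then [sOn (coinWire n k m j), sOn (coinWire n k m j),
        sOn (coinWire n k m j)] else []⟩ : QCircuit cliffordT _).toMatrix 0 *ᵥ basisState z =
        (if σ j && z (coinWire n k m j) then -Complex.I else 1) • basisState z := by
      cases σ j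
      · simp
      · simp only [if_true, Bool.true_and]
        exact sss_mulVec_basisState _ z
    rw [hhead, Matrix.mulVec_smul, ih, smul_smul, List.map_cons, List.prod_cons, mul_comm]

/-- **The phase layer on `x y ρ`**: multiplication by `sPhase σ y = (-i)^{#{j : σ j ∧ y j}}`.
[cite: Kitaev1995, §3 Remark 8] -/
theorem phaseLayer_mulVec_tri (σ : Fin k → Bool) (x : QReg n) (y : QReg k) (ρ : QReg m) :
    (⟨phaseLayer n k m σ⟩ : QCircuit cliffordT _).toMatrix 0 *ᵥ basisState (tri x y ρ) =
      sPhase σ y • basisState (tri x y ρ) := by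
  rw [phaseLayer, phaseLayerL_mulVec_basisState, ← List.ofFn_eq_map, List.prod_ofFn, sPhase]
  congr 1
  exact prod_congr rfl fun j _ => by rw [tri_coinWire]

end phase

/-! ### Kitaev's circuit and its output amplitudes -/

section circuit

variable {n k m : ℕ}

/-- **Kitaev's eigenvalue-measurement circuit** (Kitaev 1995, §3, Remark 8 with Lemma 8 and
the operator `U^{[0,r]}` of Lemma 10, all tests in parallel): Hadamard on the `k` control wires;
the classical block `V` (meant to compute `|x⟩|y⟩|0^m⟩ ↦ |x⟩|y⟩|R y⟩` reversibly and
cleanly, e.g. `R y = (x^{A_1(y)} mod N, …)`); `S³` on the sine-test controls (`σ j`); Hadamard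
on the control wires. [cite: Kitaev1995, §3 (Remark 8, Lemma 8, Lemma 10)] -/
def kitaevCircuit (V : QCircuit cliffordT (n + (k + m))) (σ : Fin k → Bool) :
    QCircuit cliffordT (n + (k + m)) :=
  ⟨hadamardLayer n k m ++ V.gates ++ phaseLayer n k m σ ++ hadamardLayer n k m⟩

/-- Kitaev's circuit is oracle-free if its classical block is. [folklore] -/
theorem kitaevCircuit_isOracleFree {V : QCircuit cliffordT (n + (k + m))} (hV : V.IsOracleFree)
    (σ : Fin k → Bool) : (kitaevCircuit V σ).IsOracleFree := by
  intro g hg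
  simp only [kitaevCircuit, List.mem_append] at hg
  rcases hg with ((hg | hg) | hg) | hg
  · obtain ⟨i, -, rfl⟩ := List.mem_map.1 hg; exact hOn_isOracleFree i
  · exact hV g hg
  · exact phaseLayerL_isOracleFree _ _ g hg
  · obtain ⟨i, -, rfl⟩ := List.mem_map.1 hg; exact hOn_isOracleFree i

/-- **The output state of Kitaev's circuit** on `|x⟩|0^k⟩|0^m⟩`, for a classical block acting
as `|x y 0^m⟩ ↦ |x y (R y)⟩`:
`2^{-k} ∑_{y, y'} (-i)^{#σ∧y} (-1)^{y·y'} |x y' (R y)⟩`. [cite: Kitaev1995, §3 (Remark 8, Lemma 8)] -/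
theorem kitaevCircuit_runOn (V : QCircuit cliffordT (n + (k + m))) (σ : Fin k → Bool)
    (x : QReg n) (R : QReg k → QReg m)
    (hV : ∀ y : QReg k, V.toMatrix 0 *ᵥ basisState (coinInput x y) = basisState (tri x y (R y))) :
    (kitaevCircuit V σ).runOn 0 (basisState (padInput x (k + m))) =
      (invSqrt2 ^ k * invSqrt2 ^ k) •
        ∑ y : QReg k, ∑ y' : QReg k, (sPhase σ y * ySign y y') • basisState (tri x y' (R y)) := by
  have hsplit : kitaevCircuit V σ =
      ((((⟨hadamardLayer n k m⟩ : QCircuit cliffordT _).append V).append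
        ⟨phaseLayer n k m σ⟩).append ⟨hadamardLayer n k m⟩) := by
    simp [kitaevCircuit, QCircuit.append]
  rw [QCircuit.runOn, hsplit, QCircuit.toMatrix_append, QCircuit.toMatrix_append,
    QCircuit.toMatrix_append, ← Matrix.mulVec_mulVec, ← Matrix.mulVec_mulVec,
    ← Matrix.mulVec_mulVec, hadamardLayer_mulVec_padInput, Matrix.mulVec_smul, Matrix.mulVec_sum,
    Finset.sum_congr rfl fun y _ => hV y, Matrix.mulVec_smul, Matrix.mulVec_sum,
    Finset.sum_congr rfl fun y _ => phaseLayer_mulVec_tri σ x y (R y), Matrix.mulVec_smul,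
    Matrix.mulVec_sum]
  simp_rw [Matrix.mulVec_smul, hadamardLayer_mulVec_tri, smul_smul, Finset.smul_sum, smul_smul]
  refine Finset.sum_congr rfl fun y _ => Finset.sum_congr rfl fun y' _ => ?_
  congr 1
  ring

/-- **The output amplitudes of Kitaev's circuit** on the labels `x γ ρ`:
`ψ(x γ ρ) = 2^{-k} ∑_{y : R y = ρ} (-i)^{#σ∧y} (-1)^{y·γ}`.
[cite: Kitaev1995, §3 (Remark 8, Lemma 8)] -/
theorem kitaevCircuit_runOn_tri (V : QCircuit cliffordT (n + (k + m))) (σ : Fin k → Bool)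
    (x : QReg n) (R : QReg k → QReg m)
    (hV : ∀ y : QReg k, V.toMatrix 0 *ᵥ basisState (coinInput x y) = basisState (tri x y (R y)))
    (γ : QReg k) (ρ : QReg m) :
    (kitaevCircuit V σ).runOn 0 (basisState (padInput x (k + m))) (tri x γ ρ) =
      (invSqrt2 ^ k * invSqrt2 ^ k) *
        ∑ y ∈ univ.filter (fun y => R y = ρ), sPhase σ y * ySign y γ := by
  classical
  rw [kitaevCircuit_runOn V σ x R hV]
  simp only [Pi.smul_apply, Finset.sum_apply, smul_eq_mul, basisState_apply, tri_eq_tri_iff,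
    true_and, mul_ite, mul_one, mul_zero]
  congr 1
  rw [Finset.sum_filter]
  refine Finset.sum_congr rfl fun y _ => ?_
  rw [Finset.sum_eq_single γ]
  · by_cases h : R y = ρ
    · rw [if_pos ⟨rfl, h.symm⟩, if_pos h]
    · rw [if_neg (fun h' => h h'.2.symm), if_neg h]
  · intro y' _ hy'
    exact if_neg fun h' => hy' h'.1.symm
  · intro h; exact absurd (Finset.mem_univ _) h

/-- Off the labels `x γ ρ` (i.e. when the input wires do not read `x`) the output amplitude of
Kitaev's circuit vanishes. [folklore] -/
theorem kitaevCircuit_runOn_of_ne (V : QCircuit cliffordT (n + (k + m))) (σ : Fin k → Bool)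
    (x : QReg n) (R : QReg k → QReg m)
    (hV : ∀ y : QReg k, V.toMatrix 0 *ᵥ basisState (coinInput x y) = basisState (tri x y (R y)))
    (x' : QReg n) (hx : x' ≠ x) (γ : QReg k) (ρ : QReg m) :
    (kitaevCircuit V σ).runOn 0 (basisState (padInput x (k + m))) (tri x' γ ρ) = 0 := by
  classical
  rw [kitaevCircuit_runOn V σ x R hV]
  simp only [Pi.smul_apply, Finset.sum_apply, smul_eq_mul, basisState_apply, tri_eq_tri_iff]
  rw [Finset.sum_eq_zero fun y _ => Finset.sum_eq_zero fun y' _ => by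
    rw [if_neg (fun h => hx h.1), mul_zero], mul_zero]

/-- **Probability of a control event.** The Born probability that the control wires of the
output of Kitaev's circuit read a string in `E` is `∑_{γ ∈ E} ∑_ρ |ψ(x γ ρ)|²`. [folklore] -/
theorem kitaevCircuit_prob_controls (V : QCircuit cliffordT (n + (k + m))) (σ : Fin k → Bool)
    (x : QReg n) (R : QReg k → QReg m)
    (hV : ∀ y : QReg k, V.toMatrix 0 *ᵥ basisState (coinInput x y) = basisState (tri x y (R y)))
    (E : Finset (QReg k)) :
    ∑ z ∈ univ.filter (fun z : QReg (n + (k + m)) => (fun j => z (coinWire n k m j)) ∈ E),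
        ‖(kitaevCircuit V σ).runOn 0 (basisState (padInput x (k + m))) z‖ ^ 2 =
      ∑ γ ∈ E, ∑ ρ : QReg m,
        ‖(kitaevCircuit V σ).runOn 0 (basisState (padInput x (k + m))) (tri x γ ρ)‖ ^ 2 := by
  classical
  set ψ := (kitaevCircuit V σ).runOn 0 (basisState (padInput x (k + m))) with hψ
  rw [Finset.sum_filter, ← Fintype.sum_equiv (triEquiv n k m)
    (fun p => if (fun j => (triEquiv n k m p) (coinWire n k m j)) ∈ E then
      ‖ψ (triEquiv n k m p)‖ ^ 2 else 0) _ (fun p => rfl)]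
  rw [Fintype.sum_prod_type, Fintype.sum_eq_single x]
  · rw [Fintype.sum_prod_type]
    have h1 : ∀ (γ : QReg k) (ρ : QReg m), (triEquiv n k m) (x, γ, ρ) = tri x γ ρ := fun _ _ => rfl
    simp only [h1, tri_coinWire]
    have h2 : ∀ γ : QReg k, ((fun j => γ j) ∈ E) = (γ ∈ E) := fun γ => rfl
    simp only [h2, Finset.sum_ite_irrel, Finset.sum_const_zero]
    rw [← Finset.sum_filter, Finset.filter_mem_eq_inter, Finset.univ_inter]
  · intro x' hx'
    rw [Fintype.sum_prod_type]
    refine Finset.sum_eq_zero fun γ _ => Finset.sum_eq_zero fun ρ _ => ?_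
    simp only [triEquiv, Equiv.coe_fn_mk]
    rw [hψ, kitaevCircuit_runOn_of_ne V σ x R hV x' hx' γ ρ, norm_zero]
    simp

end circuit

/-! ### The outcome distribution of the control read-out -/

section distribution

open Complex

variable {n k m : ℕ}

/-- The probability that a single Hadamard test reads `γ` (`false` = Kitaev's outcome `0`):
`(1 + (-1)^γ cos θ)/2` for a cosine test (`σ = false`), `(1 + (-1)^γ sin θ)/2` for a sine
test, `θ = 2πφ` (Kitaev 1995, §3, Remark 8). [cite: Kitaev1995, §3 Remark 8] -/
def testWeight (γ σ : Bool) (θ : ℝ) : ℝ :=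
  (1 + (if γ then (-1 : ℝ) else 1) * (if σ then Real.sin θ else Real.cos θ)) / 2

/-- The exponent carried by the controls of trial `t`: `A_t(y) = ∑_{j : τ j = t} y_j 2^{e_j}`.
[cite: Kitaev1995, §3 (Lemma 10)] -/
def trialExp {T : Type*} [DecidableEq T] (τ : Fin k → T) (e : Fin k → ℕ) (t : T) (y : QReg k) :
    ℕ :=
  ∑ j ∈ univ.filter (fun j => τ j = t), (y j).toNat * 2 ^ e j

/-- The test angle of control `j` under the eigenvalue index `s`: `2π s_{τ j} 2^{e_j} / r`.
[cite: Kitaev1995, §3 (Lemma 10)] -/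
def testAngle {T : Type*} (r : ℕ) (τ : Fin k → T) (e : Fin k → ℕ) (s : T → Fin r)
    (j : Fin k) : ℝ :=
  2 * Real.pi * ((s (τ j) : ℕ) : ℝ) * 2 ^ e j / r

/-- The one-bit factor `χ_j(b)` of the Kitaev amplitude for read-out `γ`:
`χ_j(0) = 1`, `χ_j(1) = (-1)^{γ_j} (-i)^{σ_j}`. [folklore] -/
theorem sPhase_mul_ySign (σ γ : Fin k → Bool) (y : QReg k) :
    sPhase σ y * ySign y γ =
      ∏ j, (if y j then (if γ j then (-1 : ℂ) else 1) * (if σ j then -I else 1) else 1) := by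
  rw [sPhase, ySign, ← prod_mul_distrib]
  refine prod_congr rfl fun j _ => ?_
  cases y j <;> cases σ j <;> cases γ j <;> simp

/-- `2^{-k/2} · 2^{-k/2} = 2^{-k}`. [folklore] -/
theorem invSqrt2_pow_mul_pow (k : ℕ) : invSqrt2 ^ k * invSqrt2 ^ k = (1 / 2 : ℂ) ^ k := by
  rw [← mul_pow, invSqrt2_mul_invSqrt2]

/-- **Kitaev's outcome distribution** (Kitaev 1995, §3: Remark 8 (single test), Lemma 8
(composite probability formula and product rule), §4 (`P(h) = q⁻¹ ∑_{h'} P(h', h)` for the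
state `|a⟩ = q^{-1/2} ∑_h |ψ_h⟩`)). If the classical block of Kitaev's circuit writes a
work-register content `R y` that separates exactly the residues of the trial exponents modulo
`r` (`R y = R y'` iff `A_t(y) ≡ A_t(y') (mod r)` for all trials `t`, as for
`R y = (x^{A_1(y)} mod N, …, x^{A_K(y)} mod N)` with `r = ord_N(x)`), then the control
read-out `γ` has Born probability
`P(γ) = r^{-K} ∑_{s ∈ (ℤ/r)^K} ∏_j testWeight γ_j σ_j (2π s_{τ j} 2^{e_j}/r)`:
a uniformly random eigenvalue index `s_t` per trial, then independent Hadamard tests.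
[cite: Kitaev1995, §3 (Remark 8, Lemma 8) and §4 (composite probability for |a>)] -/
theorem kitaevCircuit_distribution (V : QCircuit cliffordT (n + (k + m))) (σ : Fin k → Bool)
    (x : QReg n) (R : QReg k → QReg m)
    (hV : ∀ y : QReg k, V.toMatrix 0 *ᵥ basisState (coinInput x y) = basisState (tri x y (R y)))
    {T : Type*} [Fintype T] [DecidableEq T] {r : ℕ} (hr : 0 < r) (τ : Fin k → T) (e : Fin k → ℕ)
    (hR : ∀ y y' : QReg k, R y = R y' ↔
      ∀ t, (r : ℤ) ∣ (trialExp τ e t y : ℤ) - (trialExp τ e t y' : ℤ))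
    (γ : QReg k) :
    ∑ ρ : QReg m, ‖(kitaevCircuit V σ).runOn 0 (basisState (padInput x (k + m))) (tri x γ ρ)‖ ^ 2
      = (1 / (r : ℝ) ^ Fintype.card T) *
          ∑ s : T → Fin r, ∏ j, testWeight (γ j) (σ j) (testAngle r τ e s j) := by
  classical
  -- the amplitudes as fibrewise sums of `φ`
  set χ : Fin k → Bool → ℂ := fun j b =>
    if b then (if γ j then (-1 : ℂ) else 1) * (if σ j then -I else 1) else 1 with hχ
  set φ : QReg k → ℂ := fun y => (1 / 2 : ℂ) ^ k * ∏ j, χ j (y j) with hφ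
  have hamp : ∀ ρ : QReg m,
      (kitaevCircuit V σ).runOn 0 (basisState (padInput x (k + m))) (tri x γ ρ) =
        ∑ y ∈ univ.filter (fun y => R y = ρ), φ y := by
    intro ρ
    rw [kitaevCircuit_runOn_tri V σ x R hV, invSqrt2_pow_mul_pow, mul_sum]
    refine sum_congr rfl fun y _ => ?_
    rw [hφ, sPhase_mul_ySign]
  simp_rw [hamp]
  -- Parseval over `(ℤ/r)^K`
  rw [parseval_fibers hr (fun t y => (trialExp τ e t y : ℤ)) R hR φ]
  refine congrArg (fun u : ℝ => (1 / (r : ℝ) ^ Fintype.card T) * u) ?_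
  refine Finset.sum_congr rfl fun s _ => ?_
  -- factorisation of the character sum
  have hfac : ∑ y : QReg k, φ y * cexp (2 * Real.pi * I *
      ((∑ t, ((s t : ℕ) : ℂ) * ((trialExp τ e t y : ℤ) : ℂ)) / r)) =
      ∏ j, (1 + χ j true * cexp (2 * Real.pi * I * (((s (τ j) : ℕ) : ℂ) * 2 ^ e j / r))) / 2 := by
    have h1 : ∀ y : QReg k, φ y * cexp (2 * Real.pi * I *
        ((∑ t, ((s t : ℕ) : ℂ) * ((trialExp τ e t y : ℤ) : ℂ)) / r)) =
        (1 / 2 : ℂ) ^ k * ((∏ j, χ j (y j)) * cexp (2 * Real.pi * I *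
          ((∑ t, ((s t : ℕ) : ℂ) * ∑ j ∈ univ.filter (fun j => τ j = t),
            (((y j).toNat * 2 ^ e j : ℕ) : ℂ)) / r))) := by
      intro y
      rw [hφ, mul_assoc]
      congr 3
      push_cast [trialExp]
      rfl
    rw [sum_congr rfl fun y _ => h1 y, ← mul_sum,
      sum_prod_mul_exp_eq_prod r τ e χ fun t => ((s t : ℕ) : ℂ), prod_div_distrib,
      prod_const, card_univ, Fintype.card_fin]
    have hχ0 : ∀ j, χ j false = 1 := fun j => by simp [hχ]
    simp_rw [hχ0]
    rw [one_div, inv_pow, ← div_eq_inv_mul]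
  rw [hfac, norm_prod, ← prod_pow]
  refine prod_congr rfl fun j _ => ?_
  -- the single-test probability
  have := norm_sq_testAmplitude (γ j) (σ j) (testAngle r τ e s j)
  rw [testWeight, ← this, hχ]
  congr 3
  simp only [if_true]
  rw [testAngle]
  push_cast
  ring_nf

end distribution

end Kitaev1995

end Literature.Computability.Cryptography

end
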